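import Summits.QuantumFields.YangMills.Theorems.BalabanUVNodesN24NodesAtRevisedWorldOfNodes12SlotLetter
import Summits.QuantumFields.YangMills.Theorems.BalabanUVNodesK1R9BodyAtRevisedRecordWorldOfNodesWRunLetters

/-!
# NODE N24 (B2) — LINE 2′'s RUNG 1 (`K1V10Defs.NodesAtSomeRecord13PWSVW`, registered stub `stub_nodes13PWSVW` of K1 «v10») AND K1⁹ BY NAME FROM AN **ABSTRACT ADMISSIBLE WITNESS**
# (resp. WITNESS FAMILY) AND THE CHILDREN AT IT — the door-free edition of Part 38b (FLAG №9-ready: no coupling-blind witness is named here)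

TRACK A (YM-PLAN §2d, node N24 = binder B2, composite), seat `pub-ymgap-dag-n24-c` (R134 s2; gen 12); `--supports` K1⁹ stmt-QuantumFields-27364 as a helper (Summits lane); count-neutral.

WHY.  Every N24 closer of the deciding crux since Part 14 (Parts 14–38, X3 (a)∕(b), 40H∕42H, X4) is KEYED AT ONE DOOR: K0a's all-numerics family
`θᴴ := Stage13HParams.ofHistoryBlind F N ⟨theta13OfThm1CCMW F N j γ ε₀ ε₂₉ B₃ B₃' a₀ a₁, ZrOfRecord₁₃ …⟩`, with the four door lemmas (`N24_provisos₁₃SepCoPH_door_…`,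
`admissible_theta13OfThm1CCMW_of_le_half`, `ZrUnity.ofHistoryBlind ∘ finsum_ζ0_ZrOfRecord₁₃` + `slotsNondegenerate₁₃_theta13OfThm1CCMW`, `N24_laws₁₃CoPH_theta13OfThm1CCMW`) discharged
in the proof and the ten children families + N13's slot letter displayed AT that door.  That door is COUPLING-BLIND (`Efl = logz := 0`, `Record12NumericsFamilyDict` :113–114; this seat's
LOCATED I.38101, ref-H kernel check S.23519) and dag-n13-w3's p637054 `k1R9Body_false_of_logz_zero_Efl_zero` makes K1⁹'s body FALSE there — director-ym №218 FLAG №9: the closers are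
VACUOUS-IN-REGIME at that witness; what must move is the WITNESS (DEF-1 g9's Z edition `…CCMZ`, open letters `Efl`, `logz`), and №9 closes when ONE door-keyed closer is re-keyed at the
z-witness.  THIS FILE removes the door from N24's side once and for all: the same composition with the witness ABSTRACT —
`(θ : Stage13HParams F N) (hP : θ.Provisos₁₃SepCoPH) (hθ : θ.Admissible) (hU : ZhUnity ∧ SlotsNondegenerate₁₃) (hlaws : TLaw_k → SLaw_{k+1})` — and the children families READ AT `θ`.
Re-keying at ANY witness edition (today's `…CCMW`, DEF-1's `…CCMZ`, any later re-pin) is then ONE `exact` of §2∕§3∕§4 with that lane's door rows, no N24 generator pass and no new N24 file;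
vacuity becomes a property of an INSTANTIATION, never of this closer.  (Today's CCMW instance is Part 38b ∕ X4 — not restated.)

CONTENTS (theorems only; 0 `sorry`, 0 `def`, no `instance`, no `notation`; composition BY NAME — engine = Part 38a §4 `N24_nodesAtSomeRecordSV₁₃SepCoPH_of_rebindXS_fourPin_pointed_slotLetter`):
* §1 ★★ `N24_nodesAtSomeRecordSV₁₃SepCoPH_worldBuilt_childrenSplit_slotLetter_atWitness` (general `N`) — Part 38b thm 1 with the door ABSTRACTED: the rung-1ⱽ body (thirteen nodes at a world
  re-bound to `(datumOfRecord₁₃SepCoPHV θ hP v).C`, [16], the [IV] pin, `RecordSⱽ` unfolded) at `θ` from `hP hθ hU hlaws` + the children families h05…h12 + N13's slot letter h13V at `θ`;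
  the world's window letter is `min θ.γ (min γ₉ (min γ₁₁ γ₁₃))` (`0 < θ.γ` from admissibility), `βup := β₀ := 1`, `w.L := θ.L` (`Stage1Params.two_le_L`).
* §2 (`N = 2`, BY NAME) ★★ `N24_nodesAtSomeRecord13PWSV_byName_atWitness : … → K1V9Defs.NodesAtSomeRecord13PWSV F` (LINE 2's rung 1ⱽ, folded by δ) and
  ★★ `N24_nodesAtSomeRecord13PWSVW_byName_atWitness : … → K1V10Defs.NodesAtSomeRecord13PWSVW F` (LINE 2′'s rung 1ⱽᵂ, through DEF-1's door `nodesAtSomeRecord13PWSVW_of_V`).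
* §3 ★★★ `N24_stub_nodes13PWSVW_text_of_abstractWitnessFamily_of_children` — over an ABSTRACT WITNESS FAMILY `(ι : T4Family → Type) (Θ : ∀ F, ι F → Stage13HParams F 2)` with the K0 face
  `hK0 : ∀ F, K1V6Defs.Inhabited13 F → Nonempty (ι F)`, per-index door rows `hP hθ hU hlaws` and per-index children families ⊢ THE REGISTERED STUB TYPE
  `∀ F, K1V6Defs.Inhabited13 F → K1V10Defs.NodesAtSomeRecord13PWSVW F` (v10's `stub_nodes13PWSVW` over the tree mirrors).
* §4 ★★★ `N24_stabilityBRunRowsAtRecordR13SepCoPHV_byName_of_abstractWitnessFamily_of_children_of_stub2VW_stub3VW` — §3's hypotheses + the two registered β-side LINE-2′ stub TEXTS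
  (`stub_runRows13PWSVW`, `stub_cont13VW` over `K1V10Defs`) ⊢ `Summit.QuantumFields.YangMills.Theses.BalabanUVNodes.StabilityBRunRowsAtRecordR13SepCoPHV` BY NAME, through this seat's
  W-END road `…K1R9BodyAtRevisedRecordWorldOfNodesWRunLetters.stabilityBRunRowsAtRecordR13SepCoPHV_of_stubTextsVW`.
INSTANTIATION RECIPE (for the lane that lands a witness edition): `ι F :=` the subtype of door tuples meeting the K0-side antecedents; `Θ F i :=` the edition's `Stage13HParams` at `i`;
`hP ∕ hθ ∕ hU ∕ hlaws :=` that edition's four door rows; `hK0 :=` from K0⁷'s stub texts; children := the lanes' pointed suppliers at `Θ F i`.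

HONEST FRAMING: composition BY NAME; NO estimate; nothing of Bałaban's asserted; every family DISPLAYED; CONDITIONAL (the door rows, the children families, N13's slot letter, the β-side
stub texts are hypotheses — audit `proof.conditional`); NO stub of v10 is proved or closed; N05–N13 NOT discharged; N24 COMPOSITE — no count moved (typed 28∕28 · discharged 5∕27 · A 5∕28);
K0⁷ ∕ K1⁹ (DECIDING) ∕ K3⁸ OPEN; R4 = the conditional finite-𝕋⁴ rung `BalabanLadder.UV` only — NOT continuum ∕ ℝ⁴ ∕ OS ∕ mass gap ∕ Clay: the Yang–Mills mass gap is NOT proved by any of this.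
Sources (statement shapes only): [Balaban1989LargeFieldII] Thm 1 p.355, (0.1) pp.355–356, p.391; [Balaban1988Convergent] (0.2) p.244, Cor. 3 (2.50) p.264, Thm 1 p.262, Thm 2 p.263;
[Balaban1987RG1] Thm 1 p.255, Thm 3 p.264, Lemma 4 p.280, (0.17)–(0.21) pp.255–256; [Balaban1985RegularSpaces] Prop. 6 p.99, Prop. 7 (1.145) p.100, Thm 8 (1.146) p.101;
[Balaban1985UV3] Thm 1 p.257, Thm 2 p.272; [Balaban1985Variational] Thm 1 p.279, Prop. 8 p.304; [Balaban1989LargeFieldI] (0.2)–(0.6) p.176, (1.2) p.178, Prop. 1 p.194.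
-/

noncomputable section

open scoped Matrix.Norms.L2Operator BigOperators

namespace Summit.QuantumFields.YangMills.BalabanUVNodes.N24LineTwoRung1AtAbstractWitnessOfChildrenSlotLetter

open Literature.MathematicalPhysics.QuantumFieldTheory.Balaban1983to89
open Literature.MathematicalPhysics.QuantumFieldTheory.Balaban1983to89.Node00
open DagBinding T4Continuum T4DatumAssembly FlowStepRuns AveragingRT
open FlowStep (BetaLowerH BetaUpperH RGEqH prefixOf)
open Summit.QuantumFields.YangMills.BalabanUVNodes.N24NodesAtRevisedWorldOfNodes12SlotLetter (N24_nodesAtSomeRecordSV₁₃SepCoPH_of_rebindXS_fourPin_pointed_slotLetter)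
open Summit.QuantumFields.YangMills.Theorems.K1V6Defs (Inhabited13)
open Summit.QuantumFields.YangMills.Theorems.K1V9Defs (RecordSV NodesAtSomeRecord13PWSV)
open Summit.QuantumFields.YangMills.Theorems.K1V10Defs (NodesAtSomeRecord13PWSVW RunRowsAtSomeRecord13PWSVW RunRowsContAtSomeRecord13PWSVW nodesAtSomeRecord13PWSVW_of_V)
open Summit.QuantumFields.YangMills.BalabanUVNodes.K1R9BodyAtRevisedRecordWorldOfNodesWRunLetters (stabilityBRunRowsAtRecordR13SepCoPHV_of_stubTextsVW)

variable {F : T4Family} {N : ℕ} [NeZero N]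

/-! ## §1. General `N`: LINE 2's rung-1 body AT AN ABSTRACT ADMISSIBLE WITNESS from the children with N13 as the slot letter (Part 38b thm 1, door abstracted) -/

/-- **★★ LINE 2's RUNG 1 (`NodesAtSomeRecord13PWSV`'s BODY, general `N`) AT AN ABSTRACT ADMISSIBLE WITNESS `θ`, FROM THE CHILDREN — N13 READ AS THE SLOT LETTER.**  Part 38b's
`…_theta13OfThm1CCMW_…_door` with the door ABSTRACTED: in place of K0a's family and its four door lemmas, ANY `θ : Stage13HParams F N` with its provisos `hP`, admissibility `hθ`, unity ∧ slot
non-degeneracy `hU` and the 𝐑-leaf law chain `hlaws` (`TLaw_k → SLaw_{k+1}`); the ten children families (N05 on the RS P-slot `B8LeafOfRecordSubBP θ₃ λ₈` under the X-installer, N06–N12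
as in Part 23∕38b) and N13's SLOT LETTER `h13V` (SOME `γ₁₃ > 0`, exponents, a version `v : Revision₁₃ θ hP` with the two-sided (2.50) row on `v.ρ`) READ AT `θ`.  Output: the rung-1ⱽ body —
witnesses `(θ, hP, v, w)` with `w` = the S-view world on the record (`upOfRecord₅CS` over `(θ.rebindX X′ᴾ).view₁₃CoPHB10YZW`, window `min θ.γ (min γ₉ (min γ₁₁ γ₁₃))`, `βup = β₀ = 1`,
`w.L = θ.L`) RE-BOUND to `(datumOfRecord₁₃SepCoPHV θ hP v).C`; engine = Part 38a §4 BY NAME.  CONDITIONAL display; nothing discharged; names NO witness. [cite: Balaban1989LargeFieldII, Thm 1 p.355, (0.1) pp.355–356, p.391; Balaban1988Convergent, (0.2) p.244, Cor. 3 (2.50) p.264, Thm 2 p.263; Balaban1987RG1, Thm 3 p.264, Lemma 4 p.280, (0.17)–(0.20) pp.255–256; Balaban1985Variational, Thm 1 (8)–(9) p.279, Prop. 8 p.304; Balaban1985RegularSpaces, Prop. 6 p.99, Prop. 7 (1.145) p.100, Thm 8 (1.146) p.101; Balaban1985UV3, Thm 1 p.257; Balaban1989LargeFieldI, (0.2)–(0.6)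 p.176 (bookkeeping)] -/
theorem N24_nodesAtSomeRecordSV₁₃SepCoPH_worldBuilt_childrenSplit_slotLetter_atWitness (θ : Stage13HParams F N) (hP : θ.Provisos₁₃SepCoPH F N) (hθ : θ.Admissible F N)
    (hU : θ.ZhUnity F N ∧ θ.SlotsNondegenerate₁₃ F N) (hlaws : ∀ (P : B12.RunParams) (k : ℕ), k < P.K → TLaw₁₃CoPH F N θ P k → SLaw₁₃CoPH F N θ P (k + 1))
    (h05 : ∃ lam8 : ResidB8 θ.toStage3Params, B8LeafOfRecordSubBP θ.toStage3Params lam8)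
    (h06 : ∃ (Mstar : ℕ) (ops : OpsY N θ.toStage3Params Mstar), B9LeafX (Y9OfRecord N θ.toStage3Params Mstar ops))
    (h07 : ∃ ζ : ResidZ F N, B11Leaf (Z11OfRecord F N ζ))
    (h08 : PrintedUV3V N θ.L)
    (h09 : ∃ lam12 : ResidB12 F N θ.τ9.M,
      ∀ P : B12.RunParams, B12Sec2to5.Lemma4Printed (F12OfRecord₁₂ F N θ.toStage12Params lam12 P) (lam12 P).consts)
    (h09T : ∃ γ₉ : ℝ, 0 < γ₉ ∧ ∀ w : WorldP, w.C = (datumOfRecord₁₃SepCoPH F N θ hP).C →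
      w.γ ≤ γ₉ → ∀ P : B12.RunParams, (leavesP w P).smallCouplings → (leavesP w P).smallFieldInductive)
    (h10 : ∃ lam13 : B12.RunParams → ResidB13 θ.toStage3Params,
      ∀ P : B12.RunParams, B13LeafOfRecord θ.toStage3Params (lam13 P))
    (h11 : ∀ βup β₀ : ℝ, ∃ γ₁₁ : ℝ, 0 < γ₁₁ ∧ ∀ w : WorldP, w.C = (datumOfRecord₁₃SepCoPH F N θ hP).C →
      w.βup = βup → w.β₀ = β₀ → w.γ ≤ γ₁₁ → ∀ P : B12.RunParams, (leavesP w P).b7 → (leavesP w P).b8 → (leavesP w P).b9 → (leavesP w P).b10 → (leavesP w P).b11 →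
      (leavesP w P).smallCouplings → (leavesP w P).smallFieldInductive → (leavesP w P).flowControl →
        ∀ k, k < P.K → SLaw₁₃CoPH F N θ P k → TLaw₁₃CoPH F N θ P k)
    (h12 : ∃ lamW : ResidW F N, (∀ P : B12.RunParams, B15Leaf (WOfRecord₁₃ F N θ.toStage13Params lamW P)) ∧
      ∀ P : B12.RunParams, 1 ≤ P.K → lamW.kSel P < P.K)
    (h13V : ∃ γ₁₃ : ℝ, 0 < γ₁₃ ∧ ∃ em ep : ℝ → ℝ, ∃ v : Revision₁₃ F N θ hP,
      ∀ P : B12.RunParams, (genFlow (betaOfRecord₁₃ F N θ.toStage13Params) P.g0).InInterval γ₁₃ P.K → ∀ k, k ≤ P.K → SLaw₁₃CoPH F N θ P k →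
      ∀ U : GaugeField (F.P P.K) k (SU N),
        chiβOfRecord₁₃ F N θ.toStage13Params P.K (gOfRecord₁₃ F N θ.toStage13Params P) k U *
              Real.exp (-(1 / (gOfRecord₁₃ F N θ.toStage13Params P k) ^ 2 * wilsonBGOfRecord F N θ.εbg P k U)
                - em (gOfRecord₁₃ F N θ.toStage13Params P k) * (Fintype.card (Site (F.P P.K) k) : ℝ)) ≤ v.ρ P k U ∧
        v.ρ P k U ≤ Real.exp (ep (gOfRecord₁₃ F N θ.toStage13Params P k) * (Fintype.card (Site (F.P P.K) k) : ℝ))) :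
    ∃ (θ : Stage13HParams F N) (hP : θ.Provisos₁₃SepCoPH F N) (v : Revision₁₃ F N θ hP) (w : WorldP), (θ.ZhUnity F N ∧ θ.SlotsNondegenerate₁₃ F N) ∧ θ.Admissible F N ∧
      (∃ (θ' : Stage13HParams F N) (h' : θ'.Provisos₁₃SepCoPH F N), θ'.Admissible F N ∧
      datumOfRecord₁₃SepCoPH F N θ hP = datumOfRecord₁₃SepCoPH F N θ' h' ∧ w.C = (datumOfRecord₁₃SepCoPHV F N θ hP v).C ∧ (0 < w.γ ∧ w.γ ≤ θ'.γ) ∧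
      w.L = (θ'.L : ℝ) ∧ ∀ P : B12.RunParams, w.up P = upOfRecord₅CS F N (θ'.toStage5₁₃CoPH F N) P) ∧
      (∀ P : B12.RunParams, Nodes (leavesP w P)) ∧ PrintedUV3V N θ.L ∧
      ∃ lam : ResidW F N, (∀ P : B12.RunParams, 1 ≤ P.K → lam.kSel P < P.K) ∧
        ∀ P : B12.RunParams, lam.kSel P < P.K → ((leavesP w P).rBasicStep ↔ B15Leaf (WOfRecord₁₃ F N θ.toStage13Params lam P)) := by
  obtain ⟨lam8, h05⟩ := h05
  obtain ⟨Mstar, ops, h06⟩ := h06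
  obtain ⟨ζ, h07⟩ := h07
  obtain ⟨lam12, h09⟩ := h09
  obtain ⟨lam13, h10⟩ := h10
  obtain ⟨γ₉, hγ₉, h09T⟩ := h09T
  obtain ⟨γ₁₁, hγ₁₁, h11⟩ := h11 1 1
  obtain ⟨lamW, h12, hK⟩ := h12
  obtain ⟨γ₁₃, hγ₁₃, em, ep, v, hUVV⟩ := h13V
  have hL1 : (1 : ℝ) < (θ.L : ℝ) := by exact_mod_cast Nat.lt_of_lt_of_le one_lt_two (Stage1Params.two_le_L _)
  have hγ₀ : 0 < θ.γ := Stage9Params.Admissible.gamma_pos (Stage13Params.Admissible.toStage9 (show θ.toStage13Params.Admissible F N from hθ))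
  have hγw0 : 0 < min θ.γ (min γ₉ (min γ₁₁ γ₁₃)) := lt_min hγ₀ (lt_min hγ₉ (lt_min hγ₁₁ hγ₁₃))
  have hγwγ : min θ.γ (min γ₉ (min γ₁₁ γ₁₃)) ≤ θ.γ := min_le_left _ _
  have hγw9 : min θ.γ (min γ₉ (min γ₁₁ γ₁₃)) ≤ γ₉ := (min_le_right _ _).trans (min_le_left _ _)
  have hγw11 : min θ.γ (min γ₉ (min γ₁₁ γ₁₃)) ≤ γ₁₁ := (min_le_right _ _).trans ((min_le_right _ _).trans (min_le_left _ _))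
  have hγw13 : min θ.γ (min γ₉ (min γ₁₁ γ₁₃)) ≤ γ₁₃ := (min_le_right _ _).trans ((min_le_right _ _).trans (min_le_right _ _))
  set γw : ℝ := min θ.γ (min γ₉ (min γ₁₁ γ₁₃))
  let w : WorldP :=
    { C := (datumOfRecord₁₃SepCoPH F N θ hP).C
      γ := γw, em := em, ep := ep, βup := 1, β₀ := 1, β₀_pos := one_pos, b := 1, b_pos := one_pos
      L := (θ.L : ℝ), one_lt_L := hL1, gR := 0
      up := upOfRecord₅CS F N ((θ.rebindX F N (fun P : B12.RunParams => ((((θ.res.X P).withB8OfRecordSubBP θ.toStage3Params lam8).withB12 (F12OfRecord₁₂ F N θ.toStage12Params lam12 P) (lam12 P).consts).withB13OfRecord θ.toStage3Params (lam13 P)))).view₁₃CoPHB10YZW F N Mstar ops ζ lamW) }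
  have hC : w.C = (datumOfRecord₁₃SepCoPH F N θ hP).C := rfl
  have hUVw : ∀ P : B12.RunParams, (genFlow (betaOfRecord₁₃ F N θ.toStage13Params) P.g0).InInterval γ₁₃ P.K → ∀ k, k ≤ P.K → SLaw₁₃CoPH F N θ P k →
      ∀ U : GaugeField (F.P P.K) k (SU N),
        chiβOfRecord₁₃ F N θ.toStage13Params P.K (gOfRecord₁₃ F N θ.toStage13Params P) k U *
              Real.exp (-(1 / (gOfRecord₁₃ F N θ.toStage13Params P k) ^ 2 * wilsonBGOfRecord F N θ.εbg P k U)
                - w.em (gOfRecord₁₃ F N θ.toStage13Params P k) * (Fintype.card (Site (F.P P.K) k) : ℝ)) ≤ v.ρ P k U ∧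
        v.ρ P k U ≤ Real.exp (w.ep (gOfRecord₁₃ F N θ.toStage13Params P k) * (Fintype.card (Site (F.P P.K) k) : ℝ)) :=
    fun P hI k hk hS U => hUVV P hI k hk hS U
  exact N24_nodesAtSomeRecordSV₁₃SepCoPH_of_rebindXS_fourPin_pointed_slotLetter θ hP hθ hU
    (fun P : B12.RunParams => ((((θ.res.X P).withB8OfRecordSubBP θ.toStage3Params lam8).withB12 (F12OfRecord₁₂ F N θ.toStage12Params lam12 P) (lam12 P).consts).withB13OfRecord θ.toStage3Params (lam13 P))) Mstar ops ζ lamW w hC ⟨hγw0, hγwγ⟩ rfl (fun P => rfl)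
    (fun P => h05) h06 h07 h08 (fun P => h09 P) (h09T w hC hγw9) (fun P _ _ _ _ => h10 P) (h11 w hC rfl rfl hγw11) h12 hlaws v hγw13 hUVw hK


/-! ## §2. `N = 2`, BY NAME: LINE 2's rung 1ⱽ and LINE 2′'s rung 1ⱽᵂ at `F` from an abstract witness over `F` -/

/-- **★★ LINE 2's RUNG 1ⱽ BY NAME AT `F` FROM AN ABSTRACT WITNESS**: §1 at `N = 2` folded to DEF-1's tree name `K1V9Defs.NodesAtSomeRecord13PWSV F` (its `RecordSV` conjunct by δ).  CONDITIONAL;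
closes nothing. [cite: Balaban1989LargeFieldII, Thm 1 p.355, (0.1) pp.355–356; Balaban1988Convergent, Cor. 3 (2.50) p.264; Balaban1989LargeFieldI, (0.2)–(0.6) p.176 (bookkeeping)] -/
theorem N24_nodesAtSomeRecord13PWSV_byName_atWitness {F : T4Family} (θ : Stage13HParams F 2) (hP : θ.Provisos₁₃SepCoPH F 2) (hθ : θ.Admissible F 2)
    (hU : θ.ZhUnity F 2 ∧ θ.SlotsNondegenerate₁₃ F 2) (hlaws : ∀ (P : B12.RunParams) (k : ℕ), k < P.K → TLaw₁₃CoPH F 2 θ P k → SLaw₁₃CoPH F 2 θ P (k + 1))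
    (h05 : ∃ lam8 : ResidB8 θ.toStage3Params, B8LeafOfRecordSubBP θ.toStage3Params lam8)
    (h06 : ∃ (Mstar : ℕ) (ops : OpsY 2 θ.toStage3Params Mstar), B9LeafX (Y9OfRecord 2 θ.toStage3Params Mstar ops))
    (h07 : ∃ ζ : ResidZ F 2, B11Leaf (Z11OfRecord F 2 ζ))
    (h08 : PrintedUV3V 2 θ.L)
    (h09 : ∃ lam12 : ResidB12 F 2 θ.τ9.M,
      ∀ P : B12.RunParams, B12Sec2to5.Lemma4Printed (F12OfRecord₁₂ F 2 θ.toStage12Params lam12 P) (lam12 P).consts)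
    (h09T : ∃ γ₉ : ℝ, 0 < γ₉ ∧ ∀ w : WorldP, w.C = (datumOfRecord₁₃SepCoPH F 2 θ hP).C →
      w.γ ≤ γ₉ → ∀ P : B12.RunParams, (leavesP w P).smallCouplings → (leavesP w P).smallFieldInductive)
    (h10 : ∃ lam13 : B12.RunParams → ResidB13 θ.toStage3Params,
      ∀ P : B12.RunParams, B13LeafOfRecord θ.toStage3Params (lam13 P))
    (h11 : ∀ βup β₀ : ℝ, ∃ γ₁₁ : ℝ, 0 < γ₁₁ ∧ ∀ w : WorldP, w.C = (datumOfRecord₁₃SepCoPH F 2 θ hP).C →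
      w.βup = βup → w.β₀ = β₀ → w.γ ≤ γ₁₁ → ∀ P : B12.RunParams, (leavesP w P).b7 → (leavesP w P).b8 → (leavesP w P).b9 → (leavesP w P).b10 → (leavesP w P).b11 →
      (leavesP w P).smallCouplings → (leavesP w P).smallFieldInductive → (leavesP w P).flowControl →
        ∀ k, k < P.K → SLaw₁₃CoPH F 2 θ P k → TLaw₁₃CoPH F 2 θ P k)
    (h12 : ∃ lamW : ResidW F 2, (∀ P : B12.RunParams, B15Leaf (WOfRecord₁₃ F 2 θ.toStage13Params lamW P)) ∧
      ∀ P : B12.RunParams, 1 ≤ P.K → lamW.kSel P < P.K)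
    (h13V : ∃ γ₁₃ : ℝ, 0 < γ₁₃ ∧ ∃ em ep : ℝ → ℝ, ∃ v : Revision₁₃ F 2 θ hP,
      ∀ P : B12.RunParams, (genFlow (betaOfRecord₁₃ F 2 θ.toStage13Params) P.g0).InInterval γ₁₃ P.K → ∀ k, k ≤ P.K → SLaw₁₃CoPH F 2 θ P k →
      ∀ U : GaugeField (F.P P.K) k (SU 2),
        chiβOfRecord₁₃ F 2 θ.toStage13Params P.K (gOfRecord₁₃ F 2 θ.toStage13Params P) k U *
              Real.exp (-(1 / (gOfRecord₁₃ F 2 θ.toStage13Params P k) ^ 2 * wilsonBGOfRecord F 2 θ.εbg P k U)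
                - em (gOfRecord₁₃ F 2 θ.toStage13Params P k) * (Fintype.card (Site (F.P P.K) k) : ℝ)) ≤ v.ρ P k U ∧
        v.ρ P k U ≤ Real.exp (ep (gOfRecord₁₃ F 2 θ.toStage13Params P k) * (Fintype.card (Site (F.P P.K) k) : ℝ))) :
    NodesAtSomeRecord13PWSV F :=
  N24_nodesAtSomeRecordSV₁₃SepCoPH_worldBuilt_childrenSplit_slotLetter_atWitness θ hP hθ hU hlaws h05 h06 h07 h08 h09 h09T h10 h11 h12 h13V

/-- **★★ LINE 2′'s RUNG 1ⱽᵂ BY NAME AT `F` FROM AN ABSTRACT WITNESS** (the CONCLUSION of the registered `stub_nodes13PWSVW` at `F`, tree name `K1V10Defs.NodesAtSomeRecord13PWSVW F`): the previous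
theorem through DEF-1's door `nodesAtSomeRecord13PWSVW_of_V` (nodes and pin guarded by the window — weaker).  CONDITIONAL; closes nothing.
[cite: Balaban1989LargeFieldII, Thm 1 p.355, (0.1) pp.355–356; Balaban1989LargeFieldI, (1.2) p.178, Prop. 1 p.194 (bookkeeping)] -/
theorem N24_nodesAtSomeRecord13PWSVW_byName_atWitness {F : T4Family} (θ : Stage13HParams F 2) (hP : θ.Provisos₁₃SepCoPH F 2) (hθ : θ.Admissible F 2)
    (hU : θ.ZhUnity F 2 ∧ θ.SlotsNondegenerate₁₃ F 2) (hlaws : ∀ (P : B12.RunParams) (k : ℕ), k < P.K → TLaw₁₃CoPH F 2 θ P k → SLaw₁₃CoPH F 2 θ P (k + 1))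
    (h05 : ∃ lam8 : ResidB8 θ.toStage3Params, B8LeafOfRecordSubBP θ.toStage3Params lam8)
    (h06 : ∃ (Mstar : ℕ) (ops : OpsY 2 θ.toStage3Params Mstar), B9LeafX (Y9OfRecord 2 θ.toStage3Params Mstar ops))
    (h07 : ∃ ζ : ResidZ F 2, B11Leaf (Z11OfRecord F 2 ζ))
    (h08 : PrintedUV3V 2 θ.L)
    (h09 : ∃ lam12 : ResidB12 F 2 θ.τ9.M,
      ∀ P : B12.RunParams, B12Sec2to5.Lemma4Printed (F12OfRecord₁₂ F 2 θ.toStage12Params lam12 P) (lam12 P).consts)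
    (h09T : ∃ γ₉ : ℝ, 0 < γ₉ ∧ ∀ w : WorldP, w.C = (datumOfRecord₁₃SepCoPH F 2 θ hP).C →
      w.γ ≤ γ₉ → ∀ P : B12.RunParams, (leavesP w P).smallCouplings → (leavesP w P).smallFieldInductive)
    (h10 : ∃ lam13 : B12.RunParams → ResidB13 θ.toStage3Params,
      ∀ P : B12.RunParams, B13LeafOfRecord θ.toStage3Params (lam13 P))
    (h11 : ∀ βup β₀ : ℝ, ∃ γ₁₁ : ℝ, 0 < γ₁₁ ∧ ∀ w : WorldP, w.C = (datumOfRecord₁₃SepCoPH F 2 θ hP).C →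
      w.βup = βup → w.β₀ = β₀ → w.γ ≤ γ₁₁ → ∀ P : B12.RunParams, (leavesP w P).b7 → (leavesP w P).b8 → (leavesP w P).b9 → (leavesP w P).b10 → (leavesP w P).b11 →
      (leavesP w P).smallCouplings → (leavesP w P).smallFieldInductive → (leavesP w P).flowControl →
        ∀ k, k < P.K → SLaw₁₃CoPH F 2 θ P k → TLaw₁₃CoPH F 2 θ P k)
    (h12 : ∃ lamW : ResidW F 2, (∀ P : B12.RunParams, B15Leaf (WOfRecord₁₃ F 2 θ.toStage13Params lamW P)) ∧
      ∀ P : B12.RunParams, 1 ≤ P.K → lamW.kSel P < P.K)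
    (h13V : ∃ γ₁₃ : ℝ, 0 < γ₁₃ ∧ ∃ em ep : ℝ → ℝ, ∃ v : Revision₁₃ F 2 θ hP,
      ∀ P : B12.RunParams, (genFlow (betaOfRecord₁₃ F 2 θ.toStage13Params) P.g0).InInterval γ₁₃ P.K → ∀ k, k ≤ P.K → SLaw₁₃CoPH F 2 θ P k →
      ∀ U : GaugeField (F.P P.K) k (SU 2),
        chiβOfRecord₁₃ F 2 θ.toStage13Params P.K (gOfRecord₁₃ F 2 θ.toStage13Params P) k U *
              Real.exp (-(1 / (gOfRecord₁₃ F 2 θ.toStage13Params P k) ^ 2 * wilsonBGOfRecord F 2 θ.εbg P k U)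
                - em (gOfRecord₁₃ F 2 θ.toStage13Params P k) * (Fintype.card (Site (F.P P.K) k) : ℝ)) ≤ v.ρ P k U ∧
        v.ρ P k U ≤ Real.exp (ep (gOfRecord₁₃ F 2 θ.toStage13Params P k) * (Fintype.card (Site (F.P P.K) k) : ℝ))) :
    NodesAtSomeRecord13PWSVW F :=
  nodesAtSomeRecord13PWSVW_of_V (N24_nodesAtSomeRecord13PWSV_byName_atWitness θ hP hθ hU hlaws h05 h06 h07 h08 h09 h09T h10 h11 h12 h13V)

/-! ## §3. ★★★ THE REGISTERED STUB TYPE `∀ F, Inhabited13 F → NodesAtSomeRecord13PWSVW F` FROM AN ABSTRACT WITNESS FAMILY AND THE CHILDREN AT IT -/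

/-- **★★★ v10's `stub_nodes13PWSVW` TEXT (over the tree mirrors `K1V6Defs.Inhabited13`, `K1V10Defs.NodesAtSomeRecord13PWSVW`) FROM AN ABSTRACT ADMISSIBLE WITNESS FAMILY AND THE CHILDREN
AT IT.**  Data: an index type `ι F` and a family `Θ F : ι F → Stage13HParams F 2` per continuum family; the K0 FACE `hK0 : Inhabited13 F → Nonempty (ι F)` (rung 0 yields an index — for
K0a's door: the tuples `(j, c, γ, ε₀, ε₂₉, B₃, B₃', a₀, a₁, bₗ, β')` meeting V19's stub antecedents); per index the four DOOR ROWS `hP hθ hU hlaws` and the children families h05…h12 + N13's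
slot letter h13V at `Θ F i` (Part 38b's shapes with `theta13OfThm1CCMW …` ↦ `Θ F i`).  Output: the registered rung-1ⱽᵂ text at every `F` (§2 at the index `hK0` yields).  CONDITIONAL on
every displayed family; NO stub proved (the families are hypotheses); names NO witness — the instantiating lane chooses it. [cite: Balaban1989LargeFieldII, Thm 1 p.355, (0.1) pp.355–356, p.391; Balaban1988Convergent, (0.2) p.244, Cor. 3 (2.50) p.264, Thm 1 p.262; Balaban1987RG1, Thm 1 p.255, Thm 3 p.264, Lemma 4 p.280, (0.17)–(0.21) pp.255–256; Balaban1985Variational, Thm 1 (8)–(9) p.279, Prop. 8 p.304; Balaban1985RegularSpaces, Prop. 6 p.99, Thm 8 (1.146) p.101; Balaban1985UV3, Thm 1 p.257 + Thm 2 p.272; Balaban1989LargeFieldI, (0.2)–(0.6) p.176, Prop. 1 p.194 (bookkeeping)] -/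
theorem N24_stub_nodes13PWSVW_text_of_abstractWitnessFamily_of_children (ι : T4Family → Type) (Θ : ∀ F : T4Family, ι F → Stage13HParams F 2)
    (hK0 : ∀ F : T4Family, Inhabited13 F → Nonempty (ι F))
    (hP : ∀ (F : T4Family) (i : ι F), (Θ F i).Provisos₁₃SepCoPH F 2) (hθ : ∀ (F : T4Family) (i : ι F), (Θ F i).Admissible F 2)
    (hU : ∀ (F : T4Family) (i : ι F), (Θ F i).ZhUnity F 2 ∧ (Θ F i).SlotsNondegenerate₁₃ F 2)
    (hlaws : ∀ (F : T4Family) (i : ι F) (P : B12.RunParams) (k : ℕ), k < P.K → TLaw₁₃CoPH F 2 (Θ F i) P k → SLaw₁₃CoPH F 2 (Θ F i) P (k + 1))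
    (h05 : ∀ (F : T4Family) (i : ι F),
      ∃ lam8 : ResidB8 (Θ F i).toStage3Params, B8LeafOfRecordSubBP (Θ F i).toStage3Params lam8)
    (h06 : ∀ (F : T4Family) (i : ι F),
      ∃ (Mstar : ℕ) (ops : OpsY 2 (Θ F i).toStage3Params Mstar), B9LeafX (Y9OfRecord 2 (Θ F i).toStage3Params Mstar ops))
    (h07 : ∀ (F : T4Family) (i : ι F),
      ∃ ζ : ResidZ F 2, B11Leaf (Z11OfRecord F 2 ζ))
    (h08 : ∀ (F : T4Family) (i : ι F),
      PrintedUV3V 2 (Θ F i).L)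
    (h09 : ∀ (F : T4Family) (i : ι F),
      ∃ lam12 : ResidB12 F 2 (Θ F i).τ9.M,
        ∀ P : B12.RunParams, B12Sec2to5.Lemma4Printed (F12OfRecord₁₂ F 2 (Θ F i).toStage12Params lam12 P) (lam12 P).consts)
    (h09T : ∀ (F : T4Family) (i : ι F),
      ∃ γ₉ : ℝ, 0 < γ₉ ∧ ∀ w : WorldP, w.C = (datumOfRecord₁₃SepCoPH F 2 (Θ F i) (hP F i)).C →
        w.γ ≤ γ₉ → ∀ P : B12.RunParams, (leavesP w P).smallCouplings → (leavesP w P).smallFieldInductive)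
    (h10 : ∀ (F : T4Family) (i : ι F),
      ∃ lam13 : B12.RunParams → ResidB13 (Θ F i).toStage3Params,
        ∀ P : B12.RunParams, B13LeafOfRecord (Θ F i).toStage3Params (lam13 P))
    (h11 : ∀ (F : T4Family) (i : ι F),
      ∀ βup β₀ : ℝ, ∃ γ₁₁ : ℝ, 0 < γ₁₁ ∧ ∀ w : WorldP, w.C = (datumOfRecord₁₃SepCoPH F 2 (Θ F i) (hP F i)).C →
        w.βup = βup → w.β₀ = β₀ → w.γ ≤ γ₁₁ → ∀ P : B12.RunParams, (leavesP w P).b7 → (leavesP w P).b8 → (leavesP w P).b9 → (leavesP w P).b10 → (leavesP w P).b11 →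
        (leavesP w P).smallCouplings → (leavesP w P).smallFieldInductive → (leavesP w P).flowControl →
          ∀ k, k < P.K → SLaw₁₃CoPH F 2 (Θ F i) P k → TLaw₁₃CoPH F 2 (Θ F i) P k)
    (h12 : ∀ (F : T4Family) (i : ι F),
      ∃ lamW : ResidW F 2, (∀ P : B12.RunParams, B15Leaf (WOfRecord₁₃ F 2 (Θ F i).toStage13Params lamW P)) ∧
        ∀ P : B12.RunParams, 1 ≤ P.K → lamW.kSel P < P.K)
    (h13V : ∀ (F : T4Family) (i : ι F),
      ∃ γ₁₃ : ℝ, 0 < γ₁₃ ∧ ∃ em ep : ℝ → ℝ, ∃ v : Revision₁₃ F 2 (Θ F i) (hP F i),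
        ∀ P : B12.RunParams, (genFlow (betaOfRecord₁₃ F 2 (Θ F i).toStage13Params) P.g0).InInterval γ₁₃ P.K → ∀ k, k ≤ P.K → SLaw₁₃CoPH F 2 (Θ F i) P k →
        ∀ U : GaugeField (F.P P.K) k (SU 2),
          chiβOfRecord₁₃ F 2 (Θ F i).toStage13Params P.K (gOfRecord₁₃ F 2 (Θ F i).toStage13Params P) k U *
                Real.exp (-(1 / (gOfRecord₁₃ F 2 (Θ F i).toStage13Params P k) ^ 2 * wilsonBGOfRecord F 2 (Θ F i).εbg P k U)
                  - em (gOfRecord₁₃ F 2 (Θ F i).toStage13Params P k) * (Fintype.card (Site (F.P P.K) k) : ℝ)) ≤ v.ρ P k U ∧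
          v.ρ P k U ≤ Real.exp (ep (gOfRecord₁₃ F 2 (Θ F i).toStage13Params P k) * (Fintype.card (Site (F.P P.K) k) : ℝ))) :
    ∀ F : T4Family, Inhabited13 F → NodesAtSomeRecord13PWSVW F := by
  intro F hinh
  obtain ⟨i⟩ := hK0 F hinh
  exact N24_nodesAtSomeRecord13PWSVW_byName_atWitness (Θ F i) (hP F i) (hθ F i) (hU F i) (hlaws F i) (h05 F i) (h06 F i) (h07 F i) (h08 F i) (h09 F i) (h09T F i) (h10 F i) (h11 F i) (h12 F i) (h13V F i)

/-! ## §4. ★★★ K1⁹ BY NAME from the abstract witness family, the children, and the two registered β-side LINE-2′ stub texts (through the W-END road) -/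

/-- **★★★ THE DECIDING CRUX `StabilityBRunRowsAtRecordR13SepCoPHV` (K1⁹, stmt-QuantumFields-27364) BY NAME FROM AN ABSTRACT WITNESS FAMILY + THE CHILDREN + THE TWO REGISTERED β-SIDE
LINE-2′ STUB TEXTS** (`h₂` = `stub_runRows13PWSVW`'s text, `h₃` = `stub_cont13VW`'s, over `K1V10Defs`): §3 feeds `stub_nodes13PWSVW`'s text, and this seat's W-END road
(`…OfNodesWRunLetters.stabilityBRunRowsAtRecordR13SepCoPHV_of_stubTextsVW` = the skeleton's `k1R9_of_stubsVW`) composes.  CONDITIONAL on every displayed family and the two β-side texts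
(NODE O's run rows (i)(iv) + (C) continuity — the wall); NO stub proved; K1⁹ OPEN; names NO witness. [cite: Balaban1989LargeFieldII, Thm 1 p.355 + (0.1) pp.355–356; Balaban1987RG1, Thm 3 p.264, (1.22) p.264, (5.10) p.293, §1 pp.263–264; Balaban1988Convergent, Cor. 3 (2.50) p.264 (bookkeeping)] -/
theorem N24_stabilityBRunRowsAtRecordR13SepCoPHV_byName_of_abstractWitnessFamily_of_children_of_stub2VW_stub3VW (ι : T4Family → Type) (Θ : ∀ F : T4Family, ι F → Stage13HParams F 2)
    (hK0 : ∀ F : T4Family, Inhabited13 F → Nonempty (ι F))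
    (hP : ∀ (F : T4Family) (i : ι F), (Θ F i).Provisos₁₃SepCoPH F 2) (hθ : ∀ (F : T4Family) (i : ι F), (Θ F i).Admissible F 2)
    (hU : ∀ (F : T4Family) (i : ι F), (Θ F i).ZhUnity F 2 ∧ (Θ F i).SlotsNondegenerate₁₃ F 2)
    (hlaws : ∀ (F : T4Family) (i : ι F) (P : B12.RunParams) (k : ℕ), k < P.K → TLaw₁₃CoPH F 2 (Θ F i) P k → SLaw₁₃CoPH F 2 (Θ F i) P (k + 1))
    (h05 : ∀ (F : T4Family) (i : ι F),
      ∃ lam8 : ResidB8 (Θ F i).toStage3Params, B8LeafOfRecordSubBP (Θ F i).toStage3Params lam8)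
    (h06 : ∀ (F : T4Family) (i : ι F),
      ∃ (Mstar : ℕ) (ops : OpsY 2 (Θ F i).toStage3Params Mstar), B9LeafX (Y9OfRecord 2 (Θ F i).toStage3Params Mstar ops))
    (h07 : ∀ (F : T4Family) (i : ι F),
      ∃ ζ : ResidZ F 2, B11Leaf (Z11OfRecord F 2 ζ))
    (h08 : ∀ (F : T4Family) (i : ι F),
      PrintedUV3V 2 (Θ F i).L)
    (h09 : ∀ (F : T4Family) (i : ι F),
      ∃ lam12 : ResidB12 F 2 (Θ F i).τ9.M,
        ∀ P : B12.RunParams, B12Sec2to5.Lemma4Printed (F12OfRecord₁₂ F 2 (Θ F i).toStage12Params lam12 P) (lam12 P).consts)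
    (h09T : ∀ (F : T4Family) (i : ι F),
      ∃ γ₉ : ℝ, 0 < γ₉ ∧ ∀ w : WorldP, w.C = (datumOfRecord₁₃SepCoPH F 2 (Θ F i) (hP F i)).C →
        w.γ ≤ γ₉ → ∀ P : B12.RunParams, (leavesP w P).smallCouplings → (leavesP w P).smallFieldInductive)
    (h10 : ∀ (F : T4Family) (i : ι F),
      ∃ lam13 : B12.RunParams → ResidB13 (Θ F i).toStage3Params,
        ∀ P : B12.RunParams, B13LeafOfRecord (Θ F i).toStage3Params (lam13 P))
    (h11 : ∀ (F : T4Family) (i : ι F),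
      ∀ βup β₀ : ℝ, ∃ γ₁₁ : ℝ, 0 < γ₁₁ ∧ ∀ w : WorldP, w.C = (datumOfRecord₁₃SepCoPH F 2 (Θ F i) (hP F i)).C →
        w.βup = βup → w.β₀ = β₀ → w.γ ≤ γ₁₁ → ∀ P : B12.RunParams, (leavesP w P).b7 → (leavesP w P).b8 → (leavesP w P).b9 → (leavesP w P).b10 → (leavesP w P).b11 →
        (leavesP w P).smallCouplings → (leavesP w P).smallFieldInductive → (leavesP w P).flowControl →
          ∀ k, k < P.K → SLaw₁₃CoPH F 2 (Θ F i) P k → TLaw₁₃CoPH F 2 (Θ F i) P k)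
    (h12 : ∀ (F : T4Family) (i : ι F),
      ∃ lamW : ResidW F 2, (∀ P : B12.RunParams, B15Leaf (WOfRecord₁₃ F 2 (Θ F i).toStage13Params lamW P)) ∧
        ∀ P : B12.RunParams, 1 ≤ P.K → lamW.kSel P < P.K)
    (h13V : ∀ (F : T4Family) (i : ι F),
      ∃ γ₁₃ : ℝ, 0 < γ₁₃ ∧ ∃ em ep : ℝ → ℝ, ∃ v : Revision₁₃ F 2 (Θ F i) (hP F i),
        ∀ P : B12.RunParams, (genFlow (betaOfRecord₁₃ F 2 (Θ F i).toStage13Params) P.g0).InInterval γ₁₃ P.K → ∀ k, k ≤ P.K → SLaw₁₃CoPH F 2 (Θ F i) P k →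
        ∀ U : GaugeField (F.P P.K) k (SU 2),
          chiβOfRecord₁₃ F 2 (Θ F i).toStage13Params P.K (gOfRecord₁₃ F 2 (Θ F i).toStage13Params P) k U *
                Real.exp (-(1 / (gOfRecord₁₃ F 2 (Θ F i).toStage13Params P k) ^ 2 * wilsonBGOfRecord F 2 (Θ F i).εbg P k U)
                  - em (gOfRecord₁₃ F 2 (Θ F i).toStage13Params P k) * (Fintype.card (Site (F.P P.K) k) : ℝ)) ≤ v.ρ P k U ∧
          v.ρ P k U ≤ Real.exp (ep (gOfRecord₁₃ F 2 (Θ F i).toStage13Params P k) * (Fintype.card (Site (F.P P.K) k) : ℝ)))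
    (h₂ : ∀ F : T4Family, NodesAtSomeRecord13PWSVW F → RunRowsAtSomeRecord13PWSVW F)
    (h₃ : ∀ F : T4Family, RunRowsAtSomeRecord13PWSVW F → RunRowsContAtSomeRecord13PWSVW F) :
    Summit.QuantumFields.YangMills.Theses.BalabanUVNodes.StabilityBRunRowsAtRecordR13SepCoPHV :=
  stabilityBRunRowsAtRecordR13SepCoPHV_of_stubTextsVW
    (N24_stub_nodes13PWSVW_text_of_abstractWitnessFamily_of_children ι Θ hK0 hP hθ hU hlaws h05 h06 h07 h08 h09 h09T h10 h11 h12 h13V) h₂ h₃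

end Summit.QuantumFields.YangMills.BalabanUVNodes.N24LineTwoRung1AtAbstractWitnessOfChildrenSlotLetter

end
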